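import Literature.NumberTheory.Sieve.CircleMethodKernel
import Mathlib.NumberTheory.ArithmeticFunction.Moebius
import Mathlib.Data.ZMod.Basic
import HarnessLib

/-!
# Drappeau 2017, §5.5: tools for matching `ℛ₁''` with Theorem 2.1 (Möbius, phases, classes)

Topic `Literature/NumberTheory/Sieve`, part of the formalisation of §5 of S. Drappeau, Proc. London
Math. Soc. (3) 114 (2017) 684–732 = arXiv:1504.05549.  To apply the quintilinear Kloosterman bound
(Theorem 2.1 there = Assing–Blomer–Li 2021 Thm 2.3) to the sums `ℛ₁''` of (5.23) one needs
(p. 20): "by Möbius inversion … relax the condition `(a₁, q₁q₂) = 1`", the sign conventions of the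
Kloosterman fraction `e(𝐧 \overline{𝐫𝐝}/(𝐬𝐜))` (negative `𝐧` ↦ complex conjugation, negative `a₂`
↦ negated inverse), and the transport of congruence classes along `q = δ q'`.  Small exact lemmas
(everything proved; no definition, no named fact):

* `ite_coprime_eq_sum_moebius`, `sum_divisors_gcd_eq_sum_filter` —
  `1_{(q,a)=1} = ∑_{δ ∣ a, δ ∣ q} μ(δ)`;
* `fourierChar_int_mul_neg_val` — `e(t·\overline{(−u)}/W) = e(−t·ū/W)` for `t ∈ ℤ`;
* `fourierChar_int_mul_val_congr` — `e(t·v/W)` only depends on `v mod W` (`t ∈ ℤ`);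
* `natCast_mul_eq_iff_of_isUnit` — classes along `q = δq'`: `δq' ≡ l ⇔ q' ≡ l δ⁻¹ (mod m)`.

## References

* S. Drappeau, Proc. London Math. Soc. (3) 114 (2017) 684–732, arXiv:1504.05549, §5.5 p. 20,
  (5.23). [cite: Drappeau2017, §5.5]
-/

noncomputable section

open Finset Real Complex
open scoped ArithmeticFunction.Moebius FourierTransform

namespace Literature.NumberTheory.Sieve

namespace Drappeau2017

/-! ### Möbius inversion for a coprimality condition -/

/-- `∑_{d ∣ n} μ(d) = [n = 1]` in `ℂ` (Mathlib's `μ * ζ = 1`; the same statement over `ℝ` is the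
tree's `sum_divisors_moebius_real`; private here — the same identity is proved in several tree files
with heavier imports). [folklore] -/
private theorem sum_divisors_moebius_complex (n : ℕ) :
    ∑ d ∈ n.divisors, (ArithmeticFunction.moebius d : ℂ) = if n = 1 then 1 else 0 := by
  have h := congrArg (fun f : ArithmeticFunction ℂ => f n)
    (ArithmeticFunction.coe_moebius_mul_coe_zeta (R := ℂ))
  simp only [ArithmeticFunction.coe_mul_zeta_apply, ArithmeticFunction.intCoe_apply,
    ArithmeticFunction.one_apply] at h
  exact h

/-- **Möbius inversion for `(q, a) = 1`**: `1_{(q,a)=1} = ∑_{δ ∣ gcd(q,a)} μ(δ)`.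
[cite: Drappeau2017, §5.5 p. 20] -/
theorem ite_coprime_eq_sum_moebius (q a : ℕ) :
    (if Nat.Coprime q a then (1 : ℂ) else 0) =
      ∑ δ ∈ (Nat.gcd q a).divisors, (ArithmeticFunction.moebius δ : ℂ) := by
  rw [sum_divisors_moebius_complex]

/-- The divisors of `gcd(q,a)` are the divisors of `a` dividing `q` (`a ≠ 0`). [folklore] -/
theorem sum_divisors_gcd_eq_sum_filter (q : ℕ) {a : ℕ} (ha : a ≠ 0) (F : ℕ → ℂ) :
    ∑ δ ∈ (Nat.gcd q a).divisors, F δ = ∑ δ ∈ a.divisors.filter (fun δ : ℕ => δ ∣ q), F δ := by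
  refine Finset.sum_congr ?_ fun _ _ => rfl
  ext δ
  rw [Nat.mem_divisors, Finset.mem_filter, Nat.mem_divisors, Nat.dvd_gcd_iff]
  constructor
  · rintro ⟨⟨h1, h2⟩, _⟩; exact ⟨⟨h2, ha⟩, h1⟩
  · rintro ⟨⟨h2, _⟩, h1⟩; exact ⟨⟨h1, h2⟩, Nat.gcd_ne_zero_right ha⟩

/-! ### Phases -/

/-- `e(t v/W)` only depends on `v mod W` when `t ∈ ℤ`: if `W ∣ v − v'` then
`e(t v/W) = e(t v'/W)`. [folklore] -/
theorem fourierChar_int_mul_congr {W : ℕ} (hW : 0 < W) (t v v' : ℤ) (h : (W : ℤ) ∣ v - v') :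
    (𝐞 ((t : ℝ) * (v : ℝ) / W) : ℂ) = 𝐞 ((t : ℝ) * (v' : ℝ) / W) := by
  obtain ⟨k, hk⟩ := h
  have hWr : (W : ℝ) ≠ 0 := by exact_mod_cast hW.ne'
  have e : (t : ℝ) * (v : ℝ) / W = (t : ℝ) * (v' : ℝ) / W + ((t * k : ℤ) : ℝ) := by
    have hv : (v : ℝ) = (v' : ℝ) + (W : ℝ) * (k : ℝ) := by
      have := congrArg (fun z : ℤ => (z : ℝ)) hk
      push_cast at this ⊢; linarith
    rw [hv]; push_cast; field_simp
  rw [e, Real.fourierChar_apply, Real.fourierChar_apply]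
  rw [show (((2 * Real.pi * ((t : ℝ) * (v' : ℝ) / W + ((t * k : ℤ) : ℝ)) : ℝ) : ℂ) * Complex.I) =
      ((2 * Real.pi * ((t : ℝ) * (v' : ℝ) / W) : ℝ) : ℂ) * Complex.I +
        ((t * k : ℤ) : ℂ) * (2 * Real.pi * Complex.I) by push_cast; ring,
    Complex.exp_add, Complex.exp_int_mul_two_pi_mul_I, mul_one]

/-- **Negated inverses**: `e(t · \overline{(-u)} / W) = e(−t·ū/W)` for `t ∈ ℤ`, `u ∈ ℤ/Wℤ`
(`\overline{·}` = `ZMod.val`).  (Used when `a₂ < 0`: `\overline{𝐫𝐝}` with `𝐫 = |a₂|n₀n₂` versus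
the inverse of `q₁a₂n₀n₂`.) [folklore] -/
theorem fourierChar_int_mul_neg_val {W : ℕ} (hW : 0 < W) (t : ℤ) (u : ZMod W) :
    (𝐞 ((t : ℝ) * (((-u).val : ℕ) : ℝ) / W) : ℂ) = 𝐞 (-((t : ℝ) * ((u.val : ℕ) : ℝ) / W)) := by
  haveI : NeZero W := ⟨hW.ne'⟩
  have hdvd : (W : ℤ) ∣ (((-u).val : ℕ) : ℤ) - (-((u.val : ℕ) : ℤ)) := by
    rw [sub_neg_eq_add, ← ZMod.intCast_zmod_eq_zero_iff_dvd]
    push_cast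
    rw [ZMod.natCast_zmod_val, ZMod.natCast_zmod_val, neg_add_cancel]
  have h := fourierChar_int_mul_congr hW t (((-u).val : ℕ) : ℤ) (-((u.val : ℕ) : ℤ)) hdvd
  push_cast at h
  rw [h]
  congr 1
  ring

/-- Complex conjugation of the Kloosterman-fraction phase: `conj e(x) = e(−x)`
(`CircleMethodKernel.conj_fourierChar_coe`, restated for products with real weights). [folklore] -/
theorem conj_mul_fourierChar (b : ℂ) (g x : ℝ) :
    starRingEnd ℂ (b * (g : ℂ) * (𝐞 x : ℂ)) = starRingEnd ℂ b * (g : ℂ) * (𝐞 (-x) : ℂ) := by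
  rw [map_mul, map_mul, Complex.conj_ofReal, CircleMethodKernel.conj_fourierChar_coe]

/-! ### Classes along `q = δ q'` -/

/-- For a unit `δ` modulo `m`: `δ q' = l` in `ZMod m` iff `q' = l δ⁻¹`. [folklore] -/
theorem natCast_mul_eq_iff_of_isUnit {m δ q' l : ℕ} (hδ : IsUnit (δ : ZMod m)) :
    ((δ * q' : ℕ) : ZMod m) = (l : ZMod m) ↔ (q' : ZMod m) = (l : ZMod m) * (δ : ZMod m)⁻¹ := by
  push_cast
  constructor
  · intro h
    rw [← h, mul_comm ((δ : ZMod m)) (q' : ZMod m), mul_assoc, ZMod.mul_inv_of_unit _ hδ, mul_one]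
  · intro h
    rw [h, mul_comm, mul_assoc, ZMod.inv_mul_of_unit _ hδ, mul_one]

/-- `Nat` congruence as equality in `ZMod`: `q % m = l % m ↔ (q : ZMod m) = l`. [folklore] -/
theorem mod_eq_mod_iff_natCast_eq (q l m : ℕ) : q % m = l % m ↔ (q : ZMod m) = (l : ZMod m) :=
  (ZMod.natCast_eq_natCast_iff' q l m).symm

end Drappeau2017

end Literature.NumberTheory.Sieve

end
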